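import Literature.NumberTheory.Automorphic.UnitaryGroupBorelInduction
import Literature.NumberTheory.Automorphic.UnitaryGroupSplitPlace
import Literature.NumberTheory.GaloisRepresentations.ClosureValuation
import HarnessLib

/-!
# Regular diagonal elements: the centraliser in `U(σ, J)(R)` is the diagonal torus, and compact subgroups of the centraliser in
# `GL_N(E_w)` are integral
(Rogawski (1990), §1.10 p. 9 «`M`, the diagonal subgroup»; §3.6 p. 31 the maximally split Cartan subgroup; §4.3 p. 43 «the maximal compact
subgroup of `T`»; Tits (1979), §3.9; Platonov–Rapinchuk (1994), §3.3)

Topic `NumberTheory/Automorphic`; namespace `Literature.NumberTheory.Automorphic` (§2 in `….UnitaryGroup`).  KERNEL mathematics only: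
theorems, no definition, no named fact, no instance, no `sorry`.  Cell `pub/hodgecm-mathlib`, programme P3a, road «D-N7-inert» (map v2
f057cb56 §1 row L8), brick «JUNCTION-Levi» FILE C1 (LEAD F0P3a-plan (g9) T8-20 (D)(1); cut-holder F0P3b-p01 (g6)).  HONEST LABEL: HC_CM is
proved only modulo the 2 remaining named inputs (hLiu418, h413) until rung 0 closes; this file discharges no named fact.

The two structural inputs the torus descent of the UNIT orbital integral at a split-torus element needs (★ `TorusOrbitalDescentUnitCanonical`
§2: «`Ψ Z(γ₀) = T`» and «`t_T(T ∩ K) = 1`» from `t_Z(compactCore Z) = 1` via ★ `compactCore_centralizer_subset_of_hom`):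
* §1 `apply_eq_zero_of_mul_diagonal_eq_diagonal_mul`, `eq_diagonal_of_mul_diagonal_eq_diagonal_mul` — a matrix commuting with `diag(d)`,
  `dᵢ − dⱼ` units for `i ≠ j`, is diagonal (any commutative ring; the ring `∏_{w∣v} L_w` is not a field).
* §2 **`UnitaryGroup.mem_torusU_iff_mem_centralizer_of_isUnit_sub`** — `Z_{U(σ,J)(R)}(t) = T` (★ `torusU`) for `t = diag(d)` regular: the
  membership equivalence `g ∈ T ↔ g ∈ Z(t)` (the `hHH′` binder shape of ★ `InvariantQuotientTransport`).
* §3 **`subgroup_le_glInt_of_isCompact_of_le_centralizer_diagonal`** — in `GL_N(E_w)`, every compact subgroup centralising a regular diagonal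
  element lies in `GL_N(𝒪_w)` (its elements are diagonal with entries in bounded, inversion-stable multiplicative sets, hence units): the `hint`
  binder of ★ `compactCore_centralizer_subset_of_hom` on the split-torus stratum — the companion of ★
  `subgroup_le_glInt_of_isCompact_of_le_centralizer_local` (residually separable case, Kottwitz).

## References
* [Rogawski1990] J. D. Rogawski, *Automorphic Representations of Unitary Groups in Three Variables*, Ann. of Math. Stud. 123 (1990), §1.10 p. 9,
  §3.6 p. 31, §4.3 p. 43.
* [Tits1979] J. Tits, *Reductive groups over local fields*, PSPM 33.1 (1979), §3.9.
* [PlatonovRapinchuk1994] V. Platonov, A. Rapinchuk, *Algebraic Groups and Number Theory* (1994), §3.3.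
-/

set_option autoImplicit false

noncomputable section

open Matrix NumberField IsDedekindDomain Topology
open scoped MatrixGroups

namespace Literature.NumberTheory.Automorphic

/-! ## §1 A matrix commuting with a regular diagonal matrix is diagonal (commutative ring, differences of the entries units) -/

section Commute

variable {R : Type*} [CommRing R] {n : Type*} [Fintype n] [DecidableEq n]

/-- **Off-diagonal entries of a matrix commuting with `diag(d)` vanish when `dᵢ − dⱼ` is a unit**: from `M·diag(d) = diag(d)·M`,
`(dᵢ − dⱼ)·Mᵢⱼ = 0`. [cite: Rogawski1990, §3.6 p. 31] [cite: PlatonovRapinchuk1994, §3.3] -/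
theorem apply_eq_zero_of_mul_diagonal_eq_diagonal_mul {M : Matrix n n R} {d : n → R} (h : M * diagonal d = diagonal d * M)
    {i j : n} (hij : IsUnit (d i - d j)) : M i j = 0 := by
  have h1 := congrFun (congrFun h i) j
  rw [mul_diagonal, diagonal_mul] at h1
  obtain ⟨u, hu⟩ := hij
  have h2 : (d i - d j) * M i j = 0 := by rw [sub_mul]; linear_combination -h1
  rw [← hu] at h2
  simpa using (Units.mul_right_eq_zero u).1 h2

/-- A matrix commuting with a regular diagonal matrix IS the diagonal matrix of its diagonal entries (the centraliser of a regular element of the split torus is the torus). [cite: Rogawski1990, §3.6 p. 31] [cite: PlatonovRapinchuk1994, §3.3] -/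
theorem eq_diagonal_of_mul_diagonal_eq_diagonal_mul {M : Matrix n n R} {d : n → R} (h : M * diagonal d = diagonal d * M)
    (hd : ∀ i j, i ≠ j → IsUnit (d i - d j)) : M = diagonal fun i => M i i := by
  ext i j
  by_cases hij : i = j
  · subst hij; rw [diagonal_apply_eq]
  · rw [diagonal_apply_ne _ hij, apply_eq_zero_of_mul_diagonal_eq_diagonal_mul h (hd i j hij)]

end Commute

/-! ## §2 `U(σ, J)(R)`: the centraliser of a regular diagonal element is the diagonal torus `T` -/

namespace UnitaryGroup

section Torus

variable {R : Type*} [CommRing R] {σ : R →+* R} {N : ℕ} {J : Matrix (Fin N) (Fin N) R}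

/-- **`Z(t) = T` for a REGULAR diagonal `t ∈ U(σ, J)(R)`** (`t = diag(d)` with `dᵢ − dⱼ` units for `i ≠ j`): an element of `U(σ, J)(R)` commutes
with `t` iff it is diagonal (iff it lies in ★ `torusU σ J`).  Stated as the membership equivalence the transport lemmas (★
`InvariantQuotientTransport`) consume. [cite: Rogawski1990, §1.10 p. 9; §3.6 p. 31] -/
theorem mem_torusU_iff_mem_centralizer_of_isUnit_sub {t : ↥(unitaryGroupOfForm σ J)} {d : Fin N → Rˣ}
    (hd : glDiagonal N R d = (t : GL (Fin N) R)) (hreg : ∀ i j, i ≠ j → IsUnit ((d i : R) - d j))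
    (g : ↥(unitaryGroupOfForm σ J)) : g ∈ torusU σ J ↔ g ∈ Subgroup.centralizer ({t} : Set ↥(unitaryGroupOfForm σ J)) := by
  rw [Subgroup.mem_centralizer_singleton_iff, mem_torusU_iff]
  constructor
  · rintro ⟨d', hd'⟩
    apply Subtype.ext
    change (g : GL (Fin N) R) * (t : GL (Fin N) R) = (t : GL (Fin N) R) * (g : GL (Fin N) R)
    rw [← hd', ← hd, ← map_mul, ← map_mul, mul_comm]
  · intro hc
    -- the underlying matrices commute
    have hcm : ((g : GL (Fin N) R) : Matrix (Fin N) (Fin N) R) * diagonal (fun i => (d i : R)) =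
        diagonal (fun i => (d i : R)) * ((g : GL (Fin N) R) : Matrix (Fin N) (Fin N) R) := by
      have h1 := congrArg (fun x : ↥(unitaryGroupOfForm σ J) => ((x : GL (Fin N) R) : Matrix (Fin N) (Fin N) R)) hc
      simp only [Subgroup.coe_mul, Units.val_mul] at h1
      rw [← hd, coe_glDiagonal] at h1
      exact h1
    -- the inverse commutes too
    have hci : g⁻¹ * t = t * g⁻¹ := by
      calc g⁻¹ * t = g⁻¹ * (t * g) * g⁻¹ := by group
        _ = g⁻¹ * (g * t) * g⁻¹ := by rw [hc]
        _ = t * g⁻¹ := by group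
    have hcmi : (((g⁻¹ : ↥(unitaryGroupOfForm σ J)) : GL (Fin N) R) : Matrix (Fin N) (Fin N) R) * diagonal (fun i => (d i : R)) =
        diagonal (fun i => (d i : R)) * (((g⁻¹ : ↥(unitaryGroupOfForm σ J)) : GL (Fin N) R) : Matrix (Fin N) (Fin N) R) := by
      have h1 := congrArg (fun x : ↥(unitaryGroupOfForm σ J) => ((x : GL (Fin N) R) : Matrix (Fin N) (Fin N) R)) hci
      simp only [Subgroup.coe_mul, Units.val_mul] at h1
      rw [← hd, coe_glDiagonal] at h1
      exact h1
    have hg := eq_diagonal_of_mul_diagonal_eq_diagonal_mul hcm hreg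
    have hgi := eq_diagonal_of_mul_diagonal_eq_diagonal_mul hcmi hreg
    -- the diagonal entries are units (`g g⁻¹ = 1`, both diagonal)
    have hmul : ((g : GL (Fin N) R) : Matrix (Fin N) (Fin N) R) * (((g⁻¹ : ↥(unitaryGroupOfForm σ J)) : GL (Fin N) R) : Matrix (Fin N) (Fin N) R) = 1 := by
      rw [Subgroup.coe_inv, Matrix.coe_units_inv, Matrix.mul_nonsing_inv _ ((Matrix.isUnit_iff_isUnit_det _).mp (Units.isUnit _))]
    have hmul' : (((g⁻¹ : ↥(unitaryGroupOfForm σ J)) : GL (Fin N) R) : Matrix (Fin N) (Fin N) R) * ((g : GL (Fin N) R) : Matrix (Fin N) (Fin N) R) = 1 := by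
      rw [Subgroup.coe_inv, Matrix.coe_units_inv, Matrix.nonsing_inv_mul _ ((Matrix.isUnit_iff_isUnit_det _).mp (Units.isUnit _))]
    have hent : ∀ i, ((g : GL (Fin N) R) : Matrix (Fin N) (Fin N) R) i i *
        (((g⁻¹ : ↥(unitaryGroupOfForm σ J)) : GL (Fin N) R) : Matrix (Fin N) (Fin N) R) i i = 1 := by
      intro i
      have h1 := congrFun (congrFun hmul i) i
      rw [hg, hgi, diagonal_mul_diagonal, diagonal_apply_eq, Matrix.one_apply_eq] at h1
      simpa using h1
    have hent' : ∀ i, (((g⁻¹ : ↥(unitaryGroupOfForm σ J)) : GL (Fin N) R) : Matrix (Fin N) (Fin N) R) i i *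
        ((g : GL (Fin N) R) : Matrix (Fin N) (Fin N) R) i i = 1 := fun i => by rw [mul_comm]; exact hent i
    refine ⟨fun i => ⟨((g : GL (Fin N) R) : Matrix (Fin N) (Fin N) R) i i,
      (((g⁻¹ : ↥(unitaryGroupOfForm σ J)) : GL (Fin N) R) : Matrix (Fin N) (Fin N) R) i i, hent i, hent' i⟩, ?_⟩
    apply Units.ext
    rw [coe_glDiagonal]
    exact hg.symm

end Torus

end UnitaryGroup

/-! ## §3 `GL_N(E_w)`: compact subgroups centralising a regular diagonal element are integral -/

section Local

open Literature.NumberTheory.GaloisRepresentations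

variable {E : Type} [Field E] [NumberField E] (N : ℕ) (w : HeightOneSpectrum (𝓞 E))

/-- **Every compact subgroup of `GL_N(E_w)` centralising a REGULAR diagonal element lies in `GL_N(𝒪_w)`**: its elements are diagonal
(§1; the eigenvalues are pairwise distinct), their diagonal entries range over bounded multiplicative subsets of `E_w^×` stable under
`x ↦ x⁻¹`, hence over units (`‖x‖ⁿ` bounded for all `n ∈ ℤ` forces `‖x‖ = 1`).  The split-torus companion of ★
`subgroup_le_glInt_of_isCompact_of_le_centralizer_local` (residually separable case); the `hint` binder of ★
`compactCore_centralizer_subset_of_hom`. [cite: Tits1979, §3.9] [cite: PlatonovRapinchuk1994, §3.3] -/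
theorem subgroup_le_glInt_of_isCompact_of_le_centralizer_diagonal {γ : GL (Fin N) (w.adicCompletion E)} {d : Fin N → w.adicCompletion E}
    (hγ : (γ : Matrix (Fin N) (Fin N) (w.adicCompletion E)) = diagonal d) (hd : ∀ i j, i ≠ j → IsUnit (d i - d j))
    (C : Subgroup (GL (Fin N) (w.adicCompletion E))) (hC : IsCompact (C : Set (GL (Fin N) (w.adicCompletion E))))
    (hCZ : C ≤ Subgroup.centralizer ({γ} : Set (GL (Fin N) (w.adicCompletion E)))) :
    C ≤ glInt N (w.adicCompletion E) := by
  -- every element of `C` is diagonal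
  have hdiag : ∀ c ∈ C, (c : Matrix (Fin N) (Fin N) (w.adicCompletion E)) =
      diagonal fun i => (c : Matrix (Fin N) (Fin N) (w.adicCompletion E)) i i := by
    intro c hc
    have h1 : c * γ = γ * c := Subgroup.mem_centralizer_singleton_iff.1 (hCZ hc)
    have h2 : (c : Matrix (Fin N) (Fin N) (w.adicCompletion E)) * diagonal d = diagonal d * (c : Matrix (Fin N) (Fin N) (w.adicCompletion E)) := by
      rw [← hγ, ← Units.val_mul, ← Units.val_mul, h1]
    exact eq_diagonal_of_mul_diagonal_eq_diagonal_mul h2 hd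
  -- the diagonal entries have norm `≤ 1`
  have hle : ∀ c ∈ C, ∀ i, ‖(c : Matrix (Fin N) (Fin N) (w.adicCompletion E)) i i‖ ≤ 1 := by
    intro c hc i
    have hcont : Continuous fun x : GL (Fin N) (w.adicCompletion E) => ‖(x : Matrix (Fin N) (Fin N) (w.adicCompletion E)) i i‖ :=
      (Units.continuous_val.matrix_elem i i).norm
    obtain ⟨M, hM⟩ := hC.bddAbove_image hcont.continuousOn
    -- `‖c_ii‖ ^ k ≤ M` for all `k`
    have hpow : ∀ k : ℕ, ‖(c : Matrix (Fin N) (Fin N) (w.adicCompletion E)) i i‖ ^ k ≤ M := by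
      intro k
      have hck : c ^ k ∈ C := C.pow_mem hc k
      have h1 : ((c ^ k : GL (Fin N) (w.adicCompletion E)) : Matrix (Fin N) (Fin N) (w.adicCompletion E)) i i =
          (c : Matrix (Fin N) (Fin N) (w.adicCompletion E)) i i ^ k := by
        rw [Units.val_pow_eq_pow_val, hdiag c hc, diagonal_pow, diagonal_apply_eq, Pi.pow_apply, diagonal_apply_eq]
      have h2 := hM ⟨c ^ k, hck, rfl⟩
      simp only at h2
      rw [h1, norm_pow] at h2
      exact h2
    by_contra hlt
    push Not at hlt
    obtain ⟨k, hk⟩ := (tendsto_pow_atTop_atTop_of_one_lt hlt).eventually_gt_atTop M |>.exists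
    exact (lt_irrefl M) ((hk.trans_le (hpow k)))
  intro c hc
  rw [UnitaryGroup.mem_glInt_adicCompletion_iff]
  have hint : ∀ c ∈ C, ∀ i j, (c : Matrix (Fin N) (Fin N) (w.adicCompletion E)) i j ∈ w.adicCompletionIntegers E := by
    intro c hc i j
    by_cases hij : i = j
    · subst hij
      exact (mem_adicCompletionIntegers_iff_norm_le_one (v := w) _).2 (hle c hc i)
    · rw [hdiag c hc, diagonal_apply_ne _ hij]
      exact Subring.zero_mem _
  exact ⟨hint c hc, hint c⁻¹ (C.inv_mem hc)⟩

end Local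

end Literature.NumberTheory.Automorphic

end
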